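import Literature.NumberTheory.Automorphic.AdelicVectorHeight      -- ★ `vecHeight`, `vecFinHeight`, `vecArchNorm`, `IsHeightFinite`
import HarnessLib

/-!
# Crux `HLiu418`, Track B road `K2_Liu`, unit U5 «DOUBLING ZETA», socket #16a (organ (IV-c)) — helper «F2»:
# the height of an OUTER PRODUCT of adelic vectors is the product of the heights, `h(x ⊗ y) = h(x) · h(y)`

Cell `hodgecm-mathlib`, crux item hLiu418 = `stmt-HodgeConjecture-24832`, route of record `HCCMUnconditional`; squad K2 ∕ K2Liu, prover K2Liu-p04 (g0)
(socket #16a `sig_K2LiuDoublingHeightDecayPointwise`, U5 ED. 5 652390c11702f8de :235; plan of record K2/STATUS 21:43Z, file (F2)).  THEOREMS ONLY over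
★ `Literature/NumberTheory/Automorphic/AdelicVectorHeight` (Godement–Garrett heights of adelic row vectors); no `def`, no instance, no notation, no
`sorry`; lane `--supports stmt-HodgeConjecture-24832 --as helper` (count-neutral).

WHY.  In the decay estimate `Φ(ι(g,1)) ≤ C ‖g‖^{-α}` the Borel–Jacquet height `‖g‖` of `g ∈ U(V)(𝔸)` involves the entries of `g` AND of
`g⁻¹ = J⁻¹ ḡᵀ J` (★ `K2LiuPluckerMinors.coe_inv_apply_of_unitary_diagonal`), i.e. coordinates of the two vectors `x_g = (1, gᵢⱼ)` and
`σ • x_g` (Galois conjugate, same height by ★ `vecHeight_galSmul`).  All of them are coordinates of the OUTER PRODUCT `x_g ⊗ (σ • x_g)` (because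
`x_g` contains the coordinate `1`), whose height is EXACTLY `h(x_g) · h(σ • x_g) = h(x_g)²` by this file; the tree's ★ `vecHeight_vecMul_le`
(`h(x M) ≤ H(M) h(x)`, ★ `AdelicVectorHeightBound`) then moves between a vector and any fixed linear image of it.  So no «concatenation» or
«domination» lemma is needed — only this multiplicativity ([Godement1964, §1.1]; [Garrett2018, §2.2]: local heights are sup-norms at finite places
and Hilbert norms at infinite ones, both multiplicative on pure tensors):

* `vecFinHeight_outer` — `h_v(x ⊗ y) = h_v(x) h_v(y)` (max of products of non-negative reals);
* `vecArchNorm_outer` — `‖x ⊗ y‖_w = ‖x‖_w ‖y‖_w` (the Euclidean norm is multiplicative on pure tensors);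
* `isHeightFinite_outer`, **`vecHeight_outer`** — `h(x ⊗ y) = h(x) · h(y)` for vectors with finite height data.

HONEST LABEL.  Count-neutral helper; `HC_CM` is proved only modulo the 7 printed citations (2 remaining named inputs: hLiu418 =
`stmt-HodgeConjecture-24832`, h413 = `stmt-HodgeConjecture-24833`) until rung 0 closes.
-/

set_option autoImplicit false
-- the mandated namespace repeats the single-problem summit's segment (`HodgeConjecture.HodgeConjecture`)
set_option linter.dupNamespace false

noncomputable section

open scoped NNReal
open NumberField IsDedekindDomain

namespace Summit.HodgeConjecture.HodgeConjecture.Cruxes.HLiu418.K2LiuVecHeightOuter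

open Literature.NumberTheory.Automorphic

variable {K : Type} [Field K] [NumberField K] {ι κ : Type*} [Fintype ι] [Fintype κ]

/-- In `ℝ≥0`, the supremum over a product index of products is the product of the suprema. [folklore] -/
theorem sup_univ_mul_eq (f : ι → ℝ≥0) (g : κ → ℝ≥0) :
    (Finset.univ.sup fun p : ι × κ => f p.1 * g p.2) = Finset.univ.sup f * Finset.univ.sup g := by
  rw [← Finset.univ_product_univ, Finset.sup_product_left]
  simp_rw [← NNReal.mul_finset_sup]
  rw [NNReal.finset_sup_mul]

/-- **`h_v(x ⊗ y) = h_v(x) · h_v(y)`** at a finite place: the sup norm is multiplicative on pure tensors. [cite: Godement1964, §1.1] -/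
theorem vecFinHeight_outer (v : HeightOneSpectrum (𝓞 K)) (x : ι → AdeleRing (𝓞 K) K) (y : κ → AdeleRing (𝓞 K) K) :
    vecFinHeight K v (fun p : ι × κ => x p.1 * y p.2) = vecFinHeight K v x * vecFinHeight K v y := by
  unfold vecFinHeight
  simp_rw [AdeleRing.mul_snd_apply, nnnorm_mul]
  exact sup_univ_mul_eq (fun i => ‖(x i).2 v‖₊) (fun j => ‖(y j).2 v‖₊)

/-- **`‖x ⊗ y‖_w = ‖x‖_w · ‖y‖_w`** at an infinite place: the Euclidean norm is multiplicative on pure tensors. [cite: Garrett2018, §2.2 (PDF p. 81)] -/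
theorem vecArchNorm_outer (w : InfinitePlace K) (x : ι → AdeleRing (𝓞 K) K) (y : κ → AdeleRing (𝓞 K) K) :
    vecArchNorm K w (fun p : ι × κ => x p.1 * y p.2) = vecArchNorm K w x * vecArchNorm K w y := by
  unfold vecArchNorm
  rw [← NNReal.sqrt_mul]
  congr 1
  simp_rw [AdeleRing.mul_fst_apply, nnnorm_mul, mul_pow]
  rw [Fintype.sum_prod_type, Finset.sum_mul_sum]

/-- The outer product of two vectors with finite height data has finite height data. [cite: Godement1964, §1.1] -/
theorem isHeightFinite_outer {x : ι → AdeleRing (𝓞 K) K} {y : κ → AdeleRing (𝓞 K) K} (hx : IsHeightFinite K x)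
    (hy : IsHeightFinite K y) : IsHeightFinite K (fun p : ι × κ => x p.1 * y p.2) := by
  unfold IsHeightFinite at hx hy ⊢
  have h : (fun v => vecFinHeight K v (fun p : ι × κ => x p.1 * y p.2)) =
      (fun v => vecFinHeight K v x) * (fun v => vecFinHeight K v y) := by
    funext v
    rw [Pi.mul_apply, vecFinHeight_outer]
  rw [h]
  exact hx.mul hy

/-- **`h(x ⊗ y) = h(x) · h(y)`** — the Godement–Garrett height is multiplicative on outer products of vectors with finite height data.
[cite: Godement1964, §1.1] [cite: Garrett2018, §2.2 (PDF p. 81)] -/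
theorem vecHeight_outer {x : ι → AdeleRing (𝓞 K) K} {y : κ → AdeleRing (𝓞 K) K} (hx : IsHeightFinite K x)
    (hy : IsHeightFinite K y) : vecHeight K (fun p : ι × κ => x p.1 * y p.2) = vecHeight K x * vecHeight K y := by
  unfold vecHeight
  simp_rw [vecArchNorm_outer, vecFinHeight_outer, mul_pow, Finset.prod_mul_distrib]
  rw [finprod_mul_distrib hx hy]
  ring

end Summit.HodgeConjecture.HodgeConjecture.Cruxes.HLiu418.K2LiuVecHeightOuter

end
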